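/-
Copyright: cell `pub-ymgap` (HUMAN RULING D-0062), Track A of `YM-PLAN.md`, DAG node N20 (= NE7b); R134 acceleration seat
`pub-ymgap-dag-n20-c` (strategy s1, generation 13), module 58.  Released under the licence of the surrounding project.
-/
import Summits.QuantumFields.YangMills.Theorems.BalabanUVNodesN20LCSChiClassSocketCorner
import HarnessLib

/-!
# YM-DAG node N20 (= NE7b), row s1, module 58: THE CORNER FLOOR OF THE K0 SOCKET — module 56's hypothesis (T♯) at a pinned LEVEL 0 forces `L² ≤ B`
# in print's regime `4N·ε(g₁) < εreg` (the K0 ROW P11 corner engine run on THIS lineage's displayed sentence)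

Track A of `YM-PLAN.md` (cell `pub-ymgap`, HUMAN RULING D-0062), node **N20** = spine estimate NE7b (`T4WeightBudget.RelWeightBound`, NOT PRINTED, NOT PROVED).
Seat `pub-ymgap-dag-n20-c` (R134, s1), generation 13, module 58 (imports module 57 `…N20LCSChiClassSocketCorner`).

WHAT IS CERTIFIED.  §1 ★★ `data_le_concl_of_socket0` — THE ENGINE with generic thresholds: on `F.P K` (`N ≥ 2`), for cubes `s₁ = L·M₁ ≤ s` partitioning the torus, a
non-wrapping 4-collar, ANY top domain `Sup`, thresholds `0 < ρ`, `4N·ρ < θ < α⋆η₁²`, `α⋆ = min(1∕109824, δ_SU∕(64L²))`: the LEVEL-0 socket sentence at `□₀^{∼4}` «every (7)-datum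
`W` at threshold `δ` along `Ω = maxDomT M₁ □₀^{∼4}` and every (2.12) minimiser `U₀` over `{PlaqSmall θ}` on `genSet Ω 1` is `ρ`-small on `Sect2.omegaPlaqsTop Ω Sup 1`» forces
`δ ≤ ρ`.  Mechanism = K0 ROW P11's corner engine (dag-n21-c `…K0VariationalThm1Top7Engine`, dag-n07-e `…N07Thm1CornerLevelZeroObstruction`) transplanted to the socket's
objects by module 57: twist the fine bond ENTERING `Ω₁` at its corner by `g`, `|g − 1| = ρ`; `W := M˙(U₁)` is a (7)-datum at threshold `δ > ρ` (fine plaquettes `≤ ρ`; coarse ones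
`≤ 16ρ∕L³` by the impulse response); a minimiser over def-R's class EXISTS (local action `≤ 8ρ²`, `16Nρ² ≤ (4Nρ)² < θ²`, boundary avoidance); the corner plaquette is in
`omegaPlaqsTop Ω Sup 1 = plaqsOf Ω₁` with all four bonds in `bondsOf Γ₀`, so the fibre pins it to `g⁻¹` and the sentence reads `ρ < ρ`.  §2 AT THE RECORD'S LETTERS:
`zero_mem_cubeIndices_sideχ`; ★★ `sq_L_le_of_hχ_zero` — module 56's `hχ` at the pinned level `j = 0` (`δ = ε(g₁)∕B`, `θ = εreg·η₁²`, `ρ = B·(ε∕B)·η₁² = ε∕L²`) forces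
`L² ≤ B` in the regime `4N·ε(g₁) < εreg < α⋆` under 56's own letters at `j = 0` (`1 ≤ M₁`, `L·M₁ ∣ 2L^{m+K}`, `L·M₁ ≤ sideχ₀`) plus non-wrapping `9·sideχ₀ + L·M₁ ≤ 2L^{m+K}`
and `0 < g₁ < 1`, `0 < A₀`; ★★ `sq_L_le_of_hχ` (56's `hχ` verbatim, any `J ∋ 0`); ★★ `not_hχ_of_lt_sq_L` (for `B < L²` the hypothesis is FALSE there).
READING (honest).  (i) The floor is PRINT-COMPATIBLE — [15] p.279 «B₃ = B₃(d, L)»; K0 ROW P11 displays `2L² ≤ B₃` as a NECESSARY letter of every `…Top7M`-type supplier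
(`…K0VariationalThm1CoP7EmptySupport.two_sq_L_le_of_variationalThm1RegSepTop7M`) — and it is ABSORBED by the regime (R) of modules 52–56, which take ANY `B > 0` into
`g⋆`.  So this is a LOCATED NUMERICS LETTER for whichever K0 edition discharges `hχ` (exit (ii) of `N20-T-SOCKET.md` §3 cannot come with `B < L²`), like module 43's `M ≫ M₂`
and module 55∕56's `M₁ ≥ 2` — NOT a defect of 56.  (ii) It COMPLETES module 56's A2 picture of (T♯): inhabited degenerately for `εreg ≤ B·ε″ = ε` (56 `hχ_of_le`, premise
unused); UNINHABITED for `B < L²` once `4N·ε < εreg < α⋆` and a level `0` is pinned (this file); open — = [15] Thm 1 (8) for def-R's χ-class — otherwise.  (iii) Repair census: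
a variant socket concluding on `plaqInside Ω_{j+1}` instead of `plaqsOf Ω_{j+1}` would dodge only THIS pinned certificate, not the phenomenon (a boundary twist of size `ε″`
one bond away cannot relax to `ε″∕L²` inside without `B ≳ L²`); it is therefore NOT filed.  (iv) Levels `j ≥ 1` are untouched: there the top domain borders `Γ_j`, where the
constraint is a `j`-fold block average, not a pin (as in K0 ROW P11: «the deeper interfaces involve [15] Prop. 2»).
HONEST FRAMING: kernel certificates about THIS LINEAGE's displayed hypothesis at the TREE's objects; nothing of Bałaban asserted or refuted; (W♮) untouched; N20 NOT
discharged; NE7b NOT PRINTED ∕ NOT PROVED; nothing continuum ∕ ℝ⁴ ∕ OS ∕ mass-gap ∕ Clay; counts unmoved; THEOREMS ONLY (0 `def`, 0 `instance`, 0 `sorry`).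
DEPENDENCES (by name): module 57 `(exists_cornerPlaq, wilsonAction4_single_le, exists_isMinimizer_plaqSmall_of_smallAction)`; K0 ROW P11 ∕ N07 lanes
`K0AveragedSingleBondFloor.(dist1_avgFun_single_star_le, avgFun_single_eq_one_of_ne_star, exp_log_ratio_le)`, `K0VariationalThm1DatumCoupling.exists_su_dist1_eq`,
`K0VariationalThm1OuterRange.plaqHol_eq_of_agreeOn_of_bonds`, `K0VariationalThm1ScaledCorner.eta_one_sq`, `N07SmallActionBoundaryAvoidance.(cornerPlaq_bonds_mem_bondsOf,
plaqHol_single_corner, mixedField_avg_self)`, `N07Thm1ScaledInterfaceInstance.dist1_plaqHol_single_le`, `T4StabilityFloorUnitary.dist1_plaqHol_le_four_mul`,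
`T3DescentFibreTower.expMeanLogSU_E_one`; NODE 00 `Sect2.(DataSmall7PTop, omegaPlaqsTop_of_ne_zero)`, `omegaPlaqs_of_ne_zero`, `avOfRecord_avg`, `epsOfRecord_pos`,
def-R `(cubeIndices, sideχ, Iχ, suppDomOfRecord)`, r11 `maxDomT`.
-/

noncomputable section

open scoped BigOperators Matrix.Norms.L2Operator

namespace Summit.QuantumFields.YangMills.BalabanUVNodes.N20LCSChiClassSocketFloor

open Literature.MathematicalPhysics.QuantumFieldTheory.Balaban1983to89
open Literature.MathematicalPhysics.QuantumFieldTheory.Balaban1983to89.T4Continuum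
open Literature.MathematicalPhysics.QuantumFieldTheory.Balaban1983to89.Node00
open B15DeterminingSets B14.Eq213DetSet B14.Eq213MaximalDomains B15Eq112TorusCover B14DomainGeom B15LatticeCubeTorus
open BlockAveraging (avgFun)
open ExpMeanLog (deltaSU expMeanLogSU deltaSU_pos)
open Literature.MathematicalPhysics.QuantumFieldTheory.Balaban1983to89.T3DescentFibreTower (expMeanLogSU_E_one)
open Summit.QuantumFields.YangMills.BalabanUVNodes.N07Thm1ScaledInterfaceInstance (dist1_plaqHol_single_le)
open Summit.QuantumFields.YangMills.BalabanUVNodes.N07SmallActionBoundaryAvoidance (cornerPlaq_bonds_mem_bondsOf plaqHol_single_corner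
  mixedField_avg_self)
open Summit.QuantumFields.YangMills.Theorems.K0VariationalThm1ScaledCorner (lt_sitesPerDir_zero eta_one_sq)
open Summit.QuantumFields.YangMills.Theorems.K0VariationalThm1DatumCoupling (exists_su_dist1_eq)
open Summit.QuantumFields.YangMills.Theorems.K0VariationalThm1OuterRange (plaqHol_eq_of_agreeOn_of_bonds)
open Literature.MathematicalPhysics.QuantumFieldTheory.Balaban1983to89.T4StabilityFloorUnitary (dist1_plaqHol_le_four_mul)
open Summit.QuantumFields.YangMills.Theorems.K0AveragedSingleBondFloor (dist1_avgFun_single_star_le avgFun_single_eq_one_of_ne_star exp_log_ratio_le)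
open Summit.QuantumFields.YangMills.BalabanUVNodes.N20LCSChiClassSocketCorner (exists_cornerPlaq wilsonAction4_single_le
  exists_isMinimizer_plaqSmall_of_smallAction)

variable {F : T4Family} {N : ℕ} [NeZero N]

/-! ## §1  ★★ THE FLOOR ENGINE with generic thresholds: the level-0 socket sentence at `□₀^{∼4}` forces «data threshold ≤ conclusion threshold» -/

/-- ★★ **THE CORNER FLOOR OF THE LEVEL-0 SOCKET, GENERIC THRESHOLDS.**  On the torus `F.P K` (`N ≥ 2`), with `s₁ = L·M₁ ≤ s`, `s₁ ∣ 2L^{m+K}`, a non-wrapping 4-collar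
(`9s + s₁ ≤ 2L^{m+K}`), ANY top domain `Sup`, and thresholds `δ` (data), `θ` (class), `ρ` (conclusion) with `0 < ρ`, `4N·ρ < θ < α⋆·η₁²`,
`α⋆ = min(1∕109824, δ_SU∕(64L²))` (the (53)-admissibility radius of the averagings of record): IF the socket sentence of module 56 at level `0` and cube `0` holds —
«every datum `W` with `Sect2.DataSmall7PTop av Ω Sup 1 (fun _ ↦ δ) W`, `Ω = maxDomT M₁ □₀^{∼4}`, and every (2.12) minimiser `U₀` over `{PlaqSmall θ}` on `genSet Ω 1` has
`PlaqSmallOn (Sect2.omegaPlaqsTop Ω Sup 1) ρ U₀`» — THEN `δ ≤ ρ`.  Mechanism (K0 ROW P11's corner engine, dag-n21-c ∕ dag-n07-e, run on def-R's uniform class): the single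
fine bond ENTERING `Ω₁` at its corner (module 57 `exists_cornerPlaq`) twisted by `g`, `|g − 1| = ρ`; its averaged family `W = M˙(U₁)` is a (7)-datum at threshold `δ`
(fine plaquettes `≤ ρ < δ`; coarse plaquettes `≤ 16ρ∕L³ < δ` by the impulse response `dist1_avgFun_single_star_le`); a minimiser over `{PlaqSmall θ}` EXISTS (module 57:
local action `≤ 2d·ρ²`, `2N·8ρ² ≤ (4Nρ)² < θ²`, boundary avoidance); the corner plaquette lies in `omegaPlaqsTop Ω Sup 1 = plaqsOf Ω₁` and all four of its bonds meet
`Γ₀ = Ω₁ᶜ` ([III] (2.2)) so the fibre PINS it to `g⁻¹`: the sentence then reads `ρ = |g⁻¹ − 1| < ρ`.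
[cite: Balaban1985Variational, (7) p.278, Thm 1 (8) p.279; Balaban1988Convergent, (2.2) p.255, (2.10)–(2.13) pp.256–257, (2.16)–(2.17) p.257; Balaban1987RG1, (0.4) p.253; Balaban1985RegularSpaces, (1.3),(1.10) p.77] -/
theorem data_le_concl_of_socket0 (K : ℕ) (hN : 2 ≤ N) {M₁ s : ℕ} (hM : 1 ≤ M₁) (hs : side (F.P K).L M₁ 1 ≤ s)
    (hdiv : side (F.P K).L M₁ 1 ∣ (F.P K).sitesPerDir 0) (hwrap : 9 * s + side (F.P K).L M₁ 1 ≤ (F.P K).sitesPerDir 0)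
    (Sup : Set (Site (F.P K) 0)) {δ θ ρ : ℝ} (hρ : 0 < ρ) (hρθ : 4 * N * ρ < θ)
    (hθ : θ < min (1 / 109824) (deltaSU (Fin N) / (64 * (F.L : ℝ) ^ 2)) * (F.P K).eta 1 ^ 2)
    (h : ∀ W : MSField (F.P K) (SU N),
      Sect2.DataSmall7PTop (avOfRecord F N K) (maxDomT M₁ (cubeEnl (F.P K) s 0 4)) Sup 1 (fun _ => δ) W →
      ∀ U₀ : GaugeField (F.P K) 0 (SU N),
        IsMinimizer (avOfRecord F N K) {U | PlaqSmall θ U} (genSet (maxDomT M₁ (cubeEnl (F.P K) s 0 4)) 1) W U₀ →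
        PlaqSmallOn (Sect2.omegaPlaqsTop (maxDomT M₁ (cubeEnl (F.P K) s 0 4)) Sup 1) ρ U₀) :
    δ ≤ ρ := by
  classical
  by_contra hδρ
  rw [not_le] at hδρ
  -- the torus `F.P K` and the local sequence `Ω`
  set Ω : ℕ → Set (Site (F.P K) 0) := maxDomT M₁ (cubeEnl (F.P K) s 0 4) with hΩ
  have hPL : (F.P K).L = F.L := T4Family.P_L F K
  have hPd : (F.P K).d = 4 := T4Family.P_d F K
  have hL11 : 11 < F.L := F.hL11
  have hLR : (12 : ℝ) ≤ F.L := by exact_mod_cast (show 12 ≤ F.L by omega)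
  have hL1 : (1 : ℝ) ≤ F.L := by linarith only [hLR]
  have hLpos : (0 : ℝ) < F.L := by linarith only [hLR]
  obtain ⟨hL2pos, hL3pos⟩ : (0 : ℝ) < (F.L : ℝ) ^ 2 ∧ (0 : ℝ) < (F.L : ℝ) ^ 3 := ⟨by positivity, by positivity⟩
  have hL2ge : (1 : ℝ) ≤ (F.L : ℝ) ^ 2 := one_le_pow₀ hL1
  have hL3ge : (32 : ℝ) ≤ (F.L : ℝ) ^ 3 := by
    have h12 : (12 : ℝ) ^ 3 ≤ (F.L : ℝ) ^ 3 := pow_le_pow_left₀ (by norm_num) hLR 3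
    norm_num at h12
    linarith only [h12]
  have hs1 : (F.P K).L ≤ side (F.P K).L M₁ 1 := by unfold side; nlinarith [hM, (F.P K).L_pos]
  have hper2 : 2 * (F.P K).L < (F.P K).sitesPerDir 0 := by omega
  have hL3 : 3 ≤ (F.P K).L := by rw [hPL]; omega
  have hj : 0 + 1 ≤ (F.P K).m + (F.P K).K := by show 0 + 1 ≤ F.m + K; have := F.hm; omega
  -- numerics of the thresholds
  have hη : (F.P K).eta 1 ^ 2 = ((F.L : ℝ) ^ 2)⁻¹ := eta_one_sq (F := F) K
  obtain ⟨δS, hδS, hδSpos, hδS3⟩ : ∃ δS : ℝ, δS = deltaSU (Fin N) ∧ 0 < δS ∧ δS ≤ 1 / 3 := ⟨_, rfl, deltaSU_pos, min_le_left _ _⟩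
  obtain ⟨α₀, hα₀⟩ : ∃ α₀ : ℝ, α₀ = min (1 / 109824) (δS / (64 * (F.L : ℝ) ^ 2)) := ⟨_, rfl⟩
  have hα₀pos : 0 < α₀ := by rw [hα₀]; exact lt_min (by norm_num) (by positivity)
  have hα₀1 : α₀ ≤ 1 / 109824 := by rw [hα₀]; exact min_le_left _ _
  have hα₀2 : α₀ ≤ δS / (64 * (F.L : ℝ) ^ 2) := by rw [hα₀]; exact min_le_right _ _
  have hθα : θ < α₀ * (F.P K).eta 1 ^ 2 := by rw [hα₀, hδS]; exact hθ
  have hη1 : (F.P K).eta 1 ^ 2 ≤ 1 := by rw [hη]; exact inv_le_one_of_one_le₀ hL2ge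
  have hηpos : 0 < (F.P K).eta 1 ^ 2 := by rw [hη]; positivity
  have hθα' : θ < α₀ := by nlinarith [hθα, hη1, hα₀pos]
  have hN2 : (2 : ℝ) ≤ N := by exact_mod_cast hN
  have hρθ' : ρ < θ := by nlinarith [hρθ, hN2, hρ]
  have hθpos : 0 < θ := hρ.trans hρθ'
  have hρsmall : ρ < 1 / 109824 := hρθ'.trans (hθα'.trans_le hα₀1)
  have hρδS : ρ < δS := by
    have h1 : δS / (64 * (F.L : ℝ) ^ 2) ≤ δS := div_le_self hδSpos.le (by nlinarith [hL2ge])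
    exact hρθ'.trans (hθα'.trans_le (hα₀2.trans h1))
  have hρ12 : ρ ≤ 1 / 2 := by linarith only [hρsmall]
  obtain ⟨hρ1, hρ2⟩ : ρ < 1 ∧ ρ ≤ 2 := ⟨by linarith only [hρ12], by linarith only [hρ12]⟩
  -- directions `μ₀ = 0 < ν₁ = 1` and the corner plaquette of `Ω₁(□₀^{∼4})` (module 57)
  set μ0 : Fin (F.P K).d := ⟨0, by rw [hPd]; norm_num⟩ with hμ0
  set ν₁ : Fin (F.P K).d := ⟨1, by rw [hPd]; norm_num⟩ with hν₁
  have hμν : μ0 < ν₁ := Fin.mk_lt_mk.2 (by norm_num)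
  obtain ⟨p, y₁, hpμ, hfar, h1, h2, h3, hx0, hxκ⟩ := exists_cornerPlaq (P := F.P K) hM hs hdiv hwrap hμν
  have hne : ν₁ ≠ p.μ := by rw [hpμ]; exact (ne_of_lt hμν).symm
  have hμ0min : ∀ ν : Fin (F.P K).d, ¬ ν < p.μ := fun ν hν => by rw [hpμ] at hν; exact Nat.not_lt_zero ν.val (Fin.lt_def.mp hν)
  rw [← hpμ] at hx0 hxκ
  set x' : Site (F.P K) 0 := p.src.shift p.ν with hx'
  -- the twist and the datum
  obtain ⟨g, hg⟩ := exists_su_dist1_eq (N := N) hN hρ.le hρ2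
  set U₁ : GaugeField (F.P K) 0 (SU N) := fun b => if b.src = x' ∧ b.dir = p.μ then g else 1 with hU₁
  set W : MSField (F.P K) (SU N) := avgFamily (avOfRecord F N K) U₁ with hW
  have hU₁q : ∀ q : Plaq (F.P K) 0, dist1 (GaugeField.plaqHol U₁ q) ≤ ρ := fun q => (dist1_plaqHol_single_le x' hμ0min g q).trans_eq hg
  -- coarse bonds of `Ū₁` (impulse response)
  obtain ⟨τ, hτ⟩ : ∃ τ : ℝ, τ = Real.exp (1 / (F.L : ℝ) ^ 3 * (-Real.log (1 - ρ))) - 1 := ⟨_, rfl⟩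
  have hτle : τ ≤ 4 * ρ / (F.L : ℝ) ^ 3 := by rw [hτ]; exact exp_log_ratio_le hρ.le hρ12 hL1
  have hτ0 : 0 ≤ τ := by
    rw [hτ, sub_nonneg]
    refine Real.one_le_exp ?_
    have : 0 ≤ -Real.log (1 - ρ) := by
      rw [neg_nonneg]; exact Real.log_nonpos (by linarith only [hρ1]) (by linarith only [hρ])
    positivity
  have hcoarse : ∀ b : PBond (F.P K) 1, dist1 (avgFun expMeanLogSU U₁ b) ≤ τ := by
    intro b
    by_cases hb : b = ⟨y₁, p.μ⟩
    · rw [hb, hτ]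
      have hmain := dist1_avgFun_single_star_le (N := N) hper2 hL3 hne y₁ x' g hx0 hxκ hg.le (hδS ▸ hρδS) hρ1
      have h3' : ((F.P K).L : ℝ) ^ ((F.P K).d - 1) = (F.L : ℝ) ^ 3 := by rw [hPL, hPd]
      rw [h3'] at hmain
      exact hmain
    · rw [avgFun_single_eq_one_of_ne_star expMeanLogSU expMeanLogSU_E_one hj hper2 y₁ x' g hx0 hxκ b hb, GaugeGroup.dist1_one]
      exact hτ0
  have hcoarseq : ∀ q : Plaq (F.P K) 1, dist1 (GaugeField.plaqHol (avgFun expMeanLogSU U₁) q) < δ := by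
    intro q
    refine (dist1_plaqHol_le_four_mul hcoarse q).trans_lt ?_
    calc 4 * τ ≤ 4 * (4 * ρ / (F.L : ℝ) ^ 3) := by linarith only [hτle]
      _ = 16 * ρ / (F.L : ℝ) ^ 3 := by ring
      _ ≤ ρ := by rw [div_le_iff₀ hL3pos]; nlinarith only [hL3ge, hρ]
      _ < δ := hδρ
  -- (7) for `W = M˙(U₁)` along `Ω` with the top domain `Sup`
  have h7 : Sect2.DataSmall7PTop (avOfRecord F N K) Ω Sup 1 (fun _ => δ) W := by
    refine ⟨fun q _ => (hU₁q q).trans_lt hδρ, fun m hm q _ => ?_⟩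
    have hm0 : m = 0 := by omega
    subst hm0
    show dist1 (GaugeField.plaqHol (Sect2.mixedField (avOfRecord F N K) (genSet Ω 1 (0 + 1))
      ((avOfRecord F N K 0).avg U₁) U₁) q) < δ
    rw [mixedField_avg_self, avOfRecord_avg]
    exact hcoarseq q
  -- a (2.12) minimiser over def-R's class `{PlaqSmall θ}` (module 57: local action + boundary avoidance)
  have hU₁cls : PlaqSmall θ U₁ := fun q => (hU₁q q).trans_lt hρθ'
  have hA : AgreeOn (genSet Ω 1) (avgFamily (avOfRecord F N K) U₁) W := fun _ _ _ => rfl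
  have hact : 2 * N * wilsonAction4 U₁ < θ ^ 2 := by
    have hAle := wilsonAction4_single_le x' hμ0min g
    have hd4 : (((F.P K).d : ℕ) : ℝ) = 4 := by rw [hPd]; norm_num
    rw [hg, hd4] at hAle
    have hN0 : (0 : ℝ) ≤ 2 * N := by positivity
    have hN1 : (1 : ℝ) ≤ N := by linarith only [hN2]
    have h4 : 0 < 4 * N * ρ := by positivity
    calc 2 * N * wilsonAction4 U₁ ≤ 2 * N * (2 * 4 * ρ ^ 2) := mul_le_mul_of_nonneg_left hAle hN0
      _ ≤ (4 * N * ρ) ^ 2 := by nlinarith only [hN1, sq_nonneg ρ, hN0]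
      _ < θ ^ 2 := by nlinarith only [hρθ, h4, hθpos]
  have hα3 : (143 * (((((F.P K).d + 4 : ℕ) : ℝ)) ^ 2 / 4) ^ 2) * α₀ ≤ 1 / 3 := by
    rw [hPd]; norm_num
    linarith only [hα₀1]
  have hα2 : 2 * α₀ ≤ 2 * deltaSU (Fin N) / ((((F.P K).d + 4) * (F.P K).L : ℕ) : ℝ) ^ 2 := by
    have h64 : ((((F.P K).d + 4) * (F.P K).L : ℕ) : ℝ) ^ 2 = 64 * (F.L : ℝ) ^ 2 := by
      rw [hPd, hPL]; push_cast; ring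
    rw [h64, mul_div_assoc, ← hδS]
    linarith only [hα₀2]
  obtain ⟨U₀, hmin⟩ := exists_isMinimizer_plaqSmall_of_smallAction F K 1 Ω hα₀pos hα3 hα2 hθpos.le hθα hU₁cls hA hact
  -- the sentence bounds the corner plaquette of `U₀` …
  have hp1 : p ∈ Sect2.omegaPlaqsTop Ω Sup 1 := by
    rw [Sect2.omegaPlaqsTop_of_ne_zero _ _ one_ne_zero, omegaPlaqs_of_ne_zero Ω one_ne_zero]
    exact Or.inr (Or.inr (Or.inr hfar))
  have hbound := h W h7 U₀ hmin p hp1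
  -- … which is pinned to `U₁`'s value `g⁻¹`
  obtain ⟨hb1, hb2, hb3, hb4⟩ := cornerPlaq_bonds_mem_bondsOf one_pos Ω p h1 h2 h3
  have hpin : GaugeField.plaqHol U₀ p = g⁻¹ := by
    rw [plaqHol_eq_of_agreeOn_of_bonds (avOfRecord F N K) hmin.2.1 p hb1 hb2 hb3 hb4]
    exact plaqHol_single_corner p g
  rw [hpin, GaugeGroup.dist1_inv, hg] at hbound
  exact lt_irrefl _ hbound

/-! ## §2  ★★ AT THE RECORD'S LETTERS: module 56's `hχ` with a pinned level `0` forces `L² ≤ B` in print's regime `4N·ε(g₁) < εreg` -/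

section Record

variable (F) (N) (ν : Stage7Numerics) (p : B12.RunParams) (g : ℕ → ℝ)

/-- The cube of index `0` is a χ₁-cube of (3.2) (its index lies in def-R's `cubeIndices`), once `L·M₁ ≤ sideχ₀` (so `sideχ₀ ≥ 1`). [cite: Balaban1988Convergent, (3.2) p.265 (bookkeeping)] -/
theorem zero_mem_cubeIndices_sideχ (hM₁ : 1 ≤ ν.M₁) (hsz : side (F.P p.K).L ν.M₁ (0 + 1) ≤ sideχ F ν p g 0) :
    (0 : Pt (F.P p.K).d) ∈ cubeIndices (F.P p.K) (sideχ F ν p g 0) := by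
  have hs0 : 0 < sideχ F ν p g 0 := lt_of_lt_of_le (side_pos (F.P p.K).L_pos hM₁ (0 + 1)) hsz
  have hT : 0 < (F.P p.K).sitesPerDir 0 := Nat.pos_of_ne_zero ((F.P p.K).sitesPerDir_ne_zero 0)
  refine Fintype.mem_piFinset.2 fun _ => Finset.mem_image.2 ⟨0, Finset.mem_range.2 (Nat.div_pos (by omega) hs0), by simp⟩

/-- ★★ **THE CORNER FLOOR OF THE K0 SOCKET AT A PINNED LEVEL `0`.**  Module 56's hypothesis `hχ` (N20-T-SOCKET.md §1: «[15] Thm 1 (R) at the top scale for def-R's χ-CLASS local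
problem at every χ_{j+1}-cube», thresholds `ε″ = ε(g_{j+1})∕B`, class `{PlaqSmall (εreg·η_{j+1}²)}`, conclusion `B·ε″·η_{j+1}²` on `Sect2.omegaPlaqsTop … (j+1)`) SPECIALISED TO THE
PINNED LEVEL `j = 0` (read at the χ₁-cube of index `0` alone) FORCES `L² ≤ B`, in the regime `4N·ε(g₁) < εreg < min(1∕109824, δ_SU∕(64L²))` (print's «ε_k small
against the regularity threshold» plus the tree's (53)-admissibility of `εreg`), under module 56's own geometric letters at `j = 0` (`1 ≤ M₁`, `L·M₁ ∣ 2L^{m+K}`, `L·M₁ ≤ sideχ₀`)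
and the non-wrapping letter `9·sideχ₀ + L·M₁ ≤ 2L^{m+K}` — §1's engine with `δ = ε∕B`, `θ = εreg·η₁²`, `ρ = B·(ε∕B)·η₁² = ε∕L²`.  READING: the floor is PRINT-COMPATIBLE ([15] p.279
«B₃ = B₃(d, L)»; K0 ROW P11 displays `2L² ≤ B₃` for every `…Top7M`-type supplier) and is ABSORBED by the regime (R) of modules 52–56 (any `B > 0`): a located numerics
letter for whichever K0 edition discharges `hχ` — not a defect of module 56, whose A2 witness `hχ_of_le` lives in the complementary regime `εreg ≤ B·ε″ = ε`.
[cite: Balaban1985Variational, (7) p.278, Thm 1 (8) p.279; Balaban1988Convergent, (2.2) p.255, (2.12)–(2.13) pp.256–257, (2.16)–(2.17) p.257, (3.2) p.265; Balaban1987RG1, (0.4) p.253] -/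
theorem sq_L_le_of_hχ_zero (hN : 2 ≤ N) (hA0 : 0 < ν.A₀) (hg0 : 0 < g (0 + 1)) (hg1 : g (0 + 1) < 1) (hM₁ : 1 ≤ ν.M₁)
    (hdiv : side (F.P p.K).L ν.M₁ (0 + 1) ∣ (F.P p.K).sitesPerDir 0) (hsz : side (F.P p.K).L ν.M₁ (0 + 1) ≤ sideχ F ν p g 0)
    (hwrap : 9 * sideχ F ν p g 0 + side (F.P p.K).L ν.M₁ (0 + 1) ≤ (F.P p.K).sitesPerDir 0)
    (hreg : 4 * N * epsOfRecord ν g (0 + 1) < ν.εreg) (hεreg : ν.εreg < min (1 / 109824) (deltaSU (Fin N) / (64 * (F.L : ℝ) ^ 2)))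
    {B : ℝ} (hB : 0 < B)
    (hχ0 : ∀ (c : Iχ F ν p g 0) (W : MSField (F.P p.K) (SU N)),
      Sect2.DataSmall7PTop (avOfRecord F N p.K) (maxDomT ν.M₁ (cubeEnl (F.P p.K) (sideχ F ν p g 0) c 4))
          (suppDomOfRecord F ν p.K (maxDomT ν.M₁ (cubeEnl (F.P p.K) (sideχ F ν p g 0) c 4))) (0 + 1) (fun _ => epsOfRecord ν g (0 + 1) / B) W →
      ∀ U₀ : GaugeField (F.P p.K) 0 (SU N),
        IsMinimizer (avOfRecord F N p.K) {U | PlaqSmall (ν.εreg * (F.P p.K).eta (0 + 1) ^ 2) U}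
            (genSet (maxDomT ν.M₁ (cubeEnl (F.P p.K) (sideχ F ν p g 0) c 4)) (0 + 1)) W U₀ →
        PlaqSmallOn (Sect2.omegaPlaqsTop (maxDomT ν.M₁ (cubeEnl (F.P p.K) (sideχ F ν p g 0) c 4))
            (suppDomOfRecord F ν p.K (maxDomT ν.M₁ (cubeEnl (F.P p.K) (sideχ F ν p g 0) c 4))) (0 + 1))
          (B * (epsOfRecord ν g (0 + 1) / B) * (F.P p.K).eta (0 + 1) ^ 2) U₀) :
    ((F.L : ℝ)) ^ 2 ≤ B := by
  set ε : ℝ := epsOfRecord ν g (0 + 1) with hεdef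
  have hε : 0 < ε := epsOfRecord_pos ν hA0 hg0 hg1
  have hL2pos : (0 : ℝ) < (F.L : ℝ) ^ 2 := by have := F.hL11; positivity
  have hη : (F.P p.K).eta 1 ^ 2 = ((F.L : ℝ) ^ 2)⁻¹ := eta_one_sq (F := F) p.K
  have hηpos : 0 < (F.P p.K).eta 1 ^ 2 := by rw [hη]; positivity
  have hBε : B * (ε / B) = ε := mul_div_cancel₀ _ hB.ne'
  have hρ : 0 < B * (ε / B) * (F.P p.K).eta (0 + 1) ^ 2 := by rw [hBε]; exact mul_pos hε hηpos
  have hρθ : 4 * N * (B * (ε / B) * (F.P p.K).eta (0 + 1) ^ 2) < ν.εreg * (F.P p.K).eta 1 ^ 2 := by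
    rw [hBε, show 4 * (N : ℝ) * (ε * (F.P p.K).eta (0 + 1) ^ 2) = (4 * N * ε) * (F.P p.K).eta 1 ^ 2 by ring]
    exact mul_lt_mul_of_pos_right hreg hηpos
  have hθ : ν.εreg * (F.P p.K).eta 1 ^ 2 < min (1 / 109824) (deltaSU (Fin N) / (64 * (F.L : ℝ) ^ 2)) * (F.P p.K).eta 1 ^ 2 :=
    mul_lt_mul_of_pos_right hεreg hηpos
  have key := data_le_concl_of_socket0 (F := F) p.K hN hM₁ hsz hdiv hwrap
    (suppDomOfRecord F ν p.K (maxDomT ν.M₁ (cubeEnl (F.P p.K) (sideχ F ν p g 0) 0 4))) hρ hρθ hθ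
    (hχ0 ⟨0, zero_mem_cubeIndices_sideχ F ν p g hM₁ hsz⟩)
  rw [hBε, show (F.P p.K).eta (0 + 1) ^ 2 = ((F.L : ℝ) ^ 2)⁻¹ from hη, ← div_eq_mul_inv, div_le_div_iff_of_pos_left hε hB hL2pos] at key
  exact key

/-- ★★ **THE SAME FOR MODULE 56's `hχ` VERBATIM** (all pinned levels `J`, as in `halves_of_le_gstar_of_any_chiClassLocal` ∕ `sum_admS_integral_le_rec_pinnedLevels_of_le_gstar_chiClassLocal`):
if `0 ∈ J`, the hypothesis forces `L² ≤ B` in the regime of `sq_L_le_of_hχ_zero`. [cite: Balaban1985Variational, Thm 1 (8) p.279; Balaban1988Convergent, (2.2) p.255, (2.16)–(2.17) p.257] -/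
theorem sq_L_le_of_hχ (hN : 2 ≤ N) (hA0 : 0 < ν.A₀) (hg0 : 0 < g (0 + 1)) (hg1 : g (0 + 1) < 1) (hM₁ : 1 ≤ ν.M₁)
    (J : Finset ℕ) (h0 : 0 ∈ J)
    (hdiv : ∀ j ∈ J, side (F.P p.K).L ν.M₁ (j + 1) ∣ (F.P p.K).sitesPerDir 0) (hsz : ∀ j ∈ J, side (F.P p.K).L ν.M₁ (j + 1) ≤ sideχ F ν p g j)
    (hwrap : 9 * sideχ F ν p g 0 + side (F.P p.K).L ν.M₁ (0 + 1) ≤ (F.P p.K).sitesPerDir 0)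
    (hreg : 4 * N * epsOfRecord ν g (0 + 1) < ν.εreg) (hεreg : ν.εreg < min (1 / 109824) (deltaSU (Fin N) / (64 * (F.L : ℝ) ^ 2)))
    {B : ℝ} (hB : 0 < B)
    (hχ : ∀ j ∈ J, ∀ (c : Iχ F ν p g j) (W : MSField (F.P p.K) (SU N)),
      Sect2.DataSmall7PTop (avOfRecord F N p.K) (maxDomT ν.M₁ (cubeEnl (F.P p.K) (sideχ F ν p g j) c 4))
          (suppDomOfRecord F ν p.K (maxDomT ν.M₁ (cubeEnl (F.P p.K) (sideχ F ν p g j) c 4))) (j + 1) (fun _ => epsOfRecord ν g (j + 1) / B) W →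
      ∀ U₀ : GaugeField (F.P p.K) 0 (SU N),
        IsMinimizer (avOfRecord F N p.K) {U | PlaqSmall (ν.εreg * (F.P p.K).eta (j + 1) ^ 2) U}
            (genSet (maxDomT ν.M₁ (cubeEnl (F.P p.K) (sideχ F ν p g j) c 4)) (j + 1)) W U₀ →
        PlaqSmallOn (Sect2.omegaPlaqsTop (maxDomT ν.M₁ (cubeEnl (F.P p.K) (sideχ F ν p g j) c 4))
            (suppDomOfRecord F ν p.K (maxDomT ν.M₁ (cubeEnl (F.P p.K) (sideχ F ν p g j) c 4))) (j + 1))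
          (B * (epsOfRecord ν g (j + 1) / B) * (F.P p.K).eta (j + 1) ^ 2) U₀) :
    ((F.L : ℝ)) ^ 2 ≤ B :=
  sq_L_le_of_hχ_zero F N ν p g hN hA0 hg0 hg1 hM₁ (hdiv 0 h0) (hsz 0 h0) hwrap hreg hεreg hB (hχ 0 h0)

/-- ★★ **CONTRAPOSITIVE — THE SOCKET IS UNINHABITED BELOW THE FLOOR**: for `B < L²`, in the regime of `sq_L_le_of_hχ_zero`, module 56's hypothesis `hχ` with `0 ∈ J` is FALSE (so the
modulo-theorems of module 56 §4 are vacuous there; their A2 witness `hχ_of_le` needs `εreg ≤ ε`, the complementary regime). [cite: Balaban1985Variational, Thm 1 (8) p.279; Balaban1988Convergent, (2.16)–(2.17) p.257] -/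
theorem not_hχ_of_lt_sq_L (hN : 2 ≤ N) (hA0 : 0 < ν.A₀) (hg0 : 0 < g (0 + 1)) (hg1 : g (0 + 1) < 1) (hM₁ : 1 ≤ ν.M₁)
    (J : Finset ℕ) (h0 : 0 ∈ J)
    (hdiv : ∀ j ∈ J, side (F.P p.K).L ν.M₁ (j + 1) ∣ (F.P p.K).sitesPerDir 0) (hsz : ∀ j ∈ J, side (F.P p.K).L ν.M₁ (j + 1) ≤ sideχ F ν p g j)
    (hwrap : 9 * sideχ F ν p g 0 + side (F.P p.K).L ν.M₁ (0 + 1) ≤ (F.P p.K).sitesPerDir 0)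
    (hreg : 4 * N * epsOfRecord ν g (0 + 1) < ν.εreg) (hεreg : ν.εreg < min (1 / 109824) (deltaSU (Fin N) / (64 * (F.L : ℝ) ^ 2)))
    {B : ℝ} (hB : 0 < B) (hBL : B < ((F.L : ℝ)) ^ 2) :
    ¬ ∀ j ∈ J, ∀ (c : Iχ F ν p g j) (W : MSField (F.P p.K) (SU N)),
      Sect2.DataSmall7PTop (avOfRecord F N p.K) (maxDomT ν.M₁ (cubeEnl (F.P p.K) (sideχ F ν p g j) c 4))
          (suppDomOfRecord F ν p.K (maxDomT ν.M₁ (cubeEnl (F.P p.K) (sideχ F ν p g j) c 4))) (j + 1) (fun _ => epsOfRecord ν g (j + 1) / B) W →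
      ∀ U₀ : GaugeField (F.P p.K) 0 (SU N),
        IsMinimizer (avOfRecord F N p.K) {U | PlaqSmall (ν.εreg * (F.P p.K).eta (j + 1) ^ 2) U}
            (genSet (maxDomT ν.M₁ (cubeEnl (F.P p.K) (sideχ F ν p g j) c 4)) (j + 1)) W U₀ →
        PlaqSmallOn (Sect2.omegaPlaqsTop (maxDomT ν.M₁ (cubeEnl (F.P p.K) (sideχ F ν p g j) c 4))
            (suppDomOfRecord F ν p.K (maxDomT ν.M₁ (cubeEnl (F.P p.K) (sideχ F ν p g j) c 4))) (j + 1))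
          (B * (epsOfRecord ν g (j + 1) / B) * (F.P p.K).eta (j + 1) ^ 2) U₀ :=
  fun hχ => absurd (sq_L_le_of_hχ F N ν p g hN hA0 hg0 hg1 hM₁ J h0 hdiv hsz hwrap hreg hεreg hB hχ) (not_le.mpr hBL)

end Record

end Summit.QuantumFields.YangMills.BalabanUVNodes.N20LCSChiClassSocketFloor

end
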